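import Summits.BirchSwinnertonDyer.Rank1Residual.Additive.WildThreeResidualShape
import Summits.BirchSwinnertonDyer.Rank1Residual.Additive.PsiThreeNewtonPolygon
import Literature.NumberTheory.NumberFields.PadicEmbeddingValuation
import HarnessLib

/-!
# V10-SHAPE, TOOL (part 1 of 2): the Hensel root of `Ψ₃ = 3x⁴ + 6Ax² + 12Bx − A²` WITH its
# valuation, the value of `Ψ₂² = 4x³ + 4Ax + 4B` at that valuation, and `3`-adic unit-part
# bookkeeping (cell `b2b-bsdres`, cross-cell pool item of the x11b3 lineage p8 for the O6 lane's
# vocabulary `Additive/WildThreeResidualShape.lean`; theorems only, 0 defs / 0 facts / 0 `@[conjecture]`)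

HONEST FRAMING (cell `b2b-bsdres`, run/shared/lean/b2b/bsd-rank1-residual/, verbatim in every file):
the goal of the cell is to DELETE the COMBINATION-SHAPED residual classes of the Birch–Swinnerton-Dyer
formula for ALL analytic-rank `≤ 1` elliptic curves over `ℚ` — "full BSD formula for every rank `≤ 1`
curve in class `C`" assembled STRICTLY from published theorems — so that the rank-`≤ 1` remainder
becomes exactly the CONSTRUCTION-SHAPED classes, which are TYPED (missing-input `Prop`s), NOT
attempted. This is not "finishing BSD". This file: THEOREMS ONLY (no definition, no named fact, no
`@[conjecture]` node, no `sorry`; net named-fact debt `0`) — pure `3`-adic analysis with no elliptic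
curve in it; nothing about any curve is asserted; census counts stay EVIDENCE; nothing is booked; no
mark of `RESIDUAL-MAP.md` moves; O6 stays OPEN.

## What is proved (the arithmetic kernel of the sequel `Additive/WildThreeStableLineSignByC6.lean`)

For `A, B ∈ ℚ` let `f(x) = 3x⁴ + 6Ax² + 12Bx − A²` (the `3`-division polynomial of the short model
`y² = x³ + Ax + B`) and `F(x) = 4x³ + 4Ax + 4B` (its `Ψ₂²`).

* §1 `PsiThreeAdic.psi3_exists_root_valuation_of_lt` — for `A, B ≠ 0` with `2v₃B + 2 ≤ 3v₃A`, `f`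
  has a NON-ZERO root in `ℚ₃` of valuation EXACTLY `ν := 2v₃A − v₃B − 1`: harvest-2 E89's
  `psi3_exists_root_of_lt` (`Additive/PsiThreeNewtonPolygon.lean` §3, the length-one first segment of
  the Newton polygon; Hensel's lemma in `ℤ₃` for `w⁻²f(uy)`, `u = 3^ν`, `w = 3^{v₃A}`, at the unit
  `a₀ = −g₀/g₁`) re-run KEEPING Hensel's `‖z − a₀‖ < ‖g′(a₀)‖ = 1`, whence `z` is a unit and
  `v₃(uz) = ν`. `PsiThreeAdic.psi2Sq_eq_of_valuation` — for the same `A, B` and ANY `x ∈ ℚ₃` of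
  valuation `ν`: `F(x) = 4B(1 + t)` with `‖t‖₃ < 1`, because `v₃(x³) = 3ν` and `v₃(Ax) = v₃A + ν` both
  exceed `v₃B` (from `3v₃A − 2v₃B ≥ 2`). Helper: `valuation_eq_zero_of_norm_sub_one_lt` (a principal unit has valuation `0`; the tree's
  `Literature.NumberTheory.NumberFields.valuation_eq_zero_of_norm_eq_one` reused, not re-declared).
* §2 unit-part bookkeeping in the currency of `Additive/WildThreeResidualShape.lean` §1
  (`unitPartThree t = t·3^{−v₃t}`, `UnitPartCongThree t ε = ‖unitPartThree t − ε‖ < 1`):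
  `unitPartThree_mul` (multiplicative), `unitPartThree_of_norm_sub_one_lt` (a principal unit is its
  own unit part), `unitPartCongThree_mul_iff` (a factor with unit part `≡ 1 (mod 3)` does not change
  the class), `unitPartThree_const` (`−1/216 = −(1/8)·3⁻³`: valuation `−3`, unit part `≡ 1`).

Nothing here mentions a curve; the sequel reads off these the side (`v₃` parity) and sign (unit part
mod `3`) of `Ψ₂²(x₀)` at the UNIQUE stable line `x₀` in terms of `c₆ = −864B`.

References: J. Neukirch, *Algebraic Number Theory* II §6 (Newton polygon) [folklore]; J. E. Cremona,
*Algorithms for Modular Elliptic Curves* (1997) §3.8 (`Ψ₃` of the short model) [Cremona1997];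
Mathlib `Mathlib.NumberTheory.Padics.Hensel`; cell file `Additive/PsiThreeNewtonPolygon.lean`
(harvest-2 GEN 42, E89).
-/

set_option autoImplicit false

noncomputable section

open Polynomial Literature.NumberTheory.QuadraticFields

namespace Summit.BirchSwinnertonDyer.Rank1Residual.Additive

/-! ## §1 `3`-adic kernel: the Hensel root WITH its valuation, and the sign at that valuation -/

namespace PsiThreeAdic

/-- A principal unit `w` (`‖w − 1‖ < 1`) is non-zero of valuation `0` (the tree's
`Literature.NumberTheory.NumberFields.valuation_eq_zero_of_norm_eq_one`). [folklore] -/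
theorem valuation_eq_zero_of_norm_sub_one_lt {p : ℕ} [Fact p.Prime] {w : ℚ_[p]}
    (hw : ‖w - 1‖ < 1) : w ≠ 0 ∧ w.valuation = 0 := by
  have hnorm : ‖w‖ = 1 := by
    have h1 : w = (w - 1) + 1 := by ring
    have hne : ‖w - 1‖ ≠ ‖(1 : ℚ_[p])‖ := by rw [norm_one]; exact hw.ne
    rw [h1, Padic.add_eq_max_of_ne hne, norm_one, max_eq_right hw.le]
  refine ⟨fun h ↦ ?_, Literature.NumberTheory.NumberFields.valuation_eq_zero_of_norm_eq_one hnorm⟩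
  rw [h, norm_zero] at hnorm
  exact zero_ne_one hnorm

/-- **The Hensel root of `Ψ₃` WITH its valuation.** For `A, B ∈ ℚ` non-zero with
`2·v₃(B) + 2 ≤ 3·v₃(A)` the quartic `3x⁴ + 6Ax² + 12Bx − A²` has a non-zero root in `ℚ₃` of
valuation EXACTLY `2v₃(A) − v₃(B) − 1` (the length-one first segment of the Newton polygon;
`psi3_exists_root_of_lt` of `PsiThreeNewtonPolygon.lean` re-run keeping Hensel's `‖z − a₀‖ < 1`,
`a₀` a unit). [folklore] -/
theorem psi3_exists_root_valuation_of_lt {A B : ℚ} (hA : A ≠ 0) (hB : B ≠ 0)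
    (hlt : 2 * padicValRat 3 B + 2 ≤ 3 * padicValRat 3 A) :
    ∃ x : ℚ_[3], x ≠ 0 ∧ x.valuation = 2 * padicValRat 3 A - padicValRat 3 B - 1 ∧
      3 * x ^ 4 + 6 * (A : ℚ_[3]) * x ^ 2 + 12 * (B : ℚ_[3]) * x - (A : ℚ_[3]) ^ 2 = 0 := by
  set a : ℤ := padicValRat 3 A with ha
  set b : ℤ := padicValRat 3 B with hb
  set ν : ℤ := 2 * a - b - 1 with hν
  have hA' : (A : ℚ_[3]) ≠ 0 := by exact_mod_cast hA
  have hB' : (B : ℚ_[3]) ≠ 0 := by exact_mod_cast hB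
  have hπ : (3 : ℚ_[3]) ≠ 0 := by norm_num
  have hvA : (A : ℚ_[3]).valuation = a := Padic.valuation_ratCast A
  have hvB : (B : ℚ_[3]).valuation = b := Padic.valuation_ratCast B
  set u : ℚ_[3] := (3 : ℚ_[3]) ^ ν with hu
  set w : ℚ_[3] := (3 : ℚ_[3]) ^ a with hw
  have hu0 : u ≠ 0 := zpow_ne_zero ν hπ
  have hw0 : w ≠ 0 := zpow_ne_zero a hπ
  have hvu : u.valuation = ν := by rw [hu, Padic.valuation_zpow, Sqrt73.valuation_three', mul_one]
  have hvw : w.valuation = a := by rw [hw, Padic.valuation_zpow, Sqrt73.valuation_three', mul_one]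
  have hvw2 : (w ^ 2)⁻¹.valuation = -(2 * a) := by
    rw [Padic.valuation_inv, Padic.valuation_pow, hvw]; push_cast; ring
  have hw2 : (w ^ 2)⁻¹ ≠ 0 := inv_ne_zero (pow_ne_zero 2 hw0)
  set g4 : ℚ_[3] := 3 * u ^ 4 * (w ^ 2)⁻¹ with hg4
  set g2 : ℚ_[3] := 6 * (A : ℚ_[3]) * u ^ 2 * (w ^ 2)⁻¹ with hg2
  set g1 : ℚ_[3] := 12 * (B : ℚ_[3]) * u * (w ^ 2)⁻¹ with hg1
  set g0 : ℚ_[3] := -((A : ℚ_[3]) ^ 2 * (w ^ 2)⁻¹) with hg0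
  have h3ne : (3 : ℚ_[3]) ≠ 0 := by norm_num
  have h6ne : (6 : ℚ_[3]) ≠ 0 := by norm_num
  have h12ne : (12 : ℚ_[3]) ≠ 0 := by norm_num
  have hg4ne : g4 ≠ 0 := mul_ne_zero (mul_ne_zero h3ne (pow_ne_zero 4 hu0)) hw2
  have hg2ne : g2 ≠ 0 := mul_ne_zero (mul_ne_zero (mul_ne_zero h6ne hA') (pow_ne_zero 2 hu0)) hw2
  have hg1ne : g1 ≠ 0 := mul_ne_zero (mul_ne_zero (mul_ne_zero h12ne hB') hu0) hw2
  have hg0ne : g0 ≠ 0 := neg_ne_zero.mpr (mul_ne_zero (pow_ne_zero 2 hA') hw2)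
  have hg4v : g4.valuation = 1 + 4 * ν - 2 * a := by
    rw [hg4, Padic.valuation_mul (mul_ne_zero h3ne (pow_ne_zero 4 hu0)) hw2,
      Padic.valuation_mul h3ne (pow_ne_zero 4 hu0), Sqrt73.valuation_three', Padic.valuation_pow, hvu, hvw2]
    push_cast; ring
  have hg2v : g2.valuation = 1 + a + 2 * ν - 2 * a := by
    rw [hg2, Padic.valuation_mul (mul_ne_zero (mul_ne_zero h6ne hA') (pow_ne_zero 2 hu0)) hw2,
      Padic.valuation_mul (mul_ne_zero h6ne hA') (pow_ne_zero 2 hu0), Padic.valuation_mul h6ne hA',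
      valuation_six, hvA, Padic.valuation_pow, hvu, hvw2]
    push_cast; ring
  have hg1v : g1.valuation = 0 := by
    rw [hg1, Padic.valuation_mul (mul_ne_zero (mul_ne_zero h12ne hB') hu0) hw2,
      Padic.valuation_mul (mul_ne_zero h12ne hB') hu0, Padic.valuation_mul h12ne hB',
      valuation_twelve, hvB, hvu, hvw2, hν]
    ring
  have hg0v : g0.valuation = 0 := by
    rw [hg0, Sqrt41.valuation_neg'', Padic.valuation_mul (pow_ne_zero 2 hA') hw2, Padic.valuation_pow, hvA,
      hvw2]
    push_cast; ring
  have hn4 : ‖g4‖ < 1 := norm_lt_one_of_valuation_pos hg4ne (by rw [hg4v]; omega)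
  have hn2 : ‖g2‖ < 1 := norm_lt_one_of_valuation_pos hg2ne (by rw [hg2v]; omega)
  have hn1 : ‖g1‖ = 1 := norm_eq_one_of_valuation_eq_zero hg1ne hg1v
  have hn0 : ‖g0‖ = 1 := norm_eq_one_of_valuation_eq_zero hg0ne hg0v
  set G4 : ℤ_[3] := ⟨g4, hn4.le⟩ with hG4
  set G2 : ℤ_[3] := ⟨g2, hn2.le⟩ with hG2
  set G1 : ℤ_[3] := ⟨g1, hn1.le⟩ with hG1
  set G0 : ℤ_[3] := ⟨g0, hn0.le⟩ with hG0
  have hN4 : ‖G4‖ < 1 := hn4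
  have hN2 : ‖G2‖ < 1 := hn2
  have hN1 : ‖G1‖ = 1 := hn1
  have hN0 : ‖G0‖ = 1 := hn0
  have hU1 : IsUnit G1 := PadicInt.isUnit_iff.mpr hN1
  set G : Polynomial ℤ_[3] := C G4 * X ^ 4 + C G2 * X ^ 2 + C G1 * X + C G0 with hG
  set a₀ : ℤ_[3] := -G0 * ↑(hU1.unit⁻¹) with ha₀
  have hinv : G1 * ↑(hU1.unit⁻¹) = 1 := hU1.mul_val_inv
  have hGeval : ∀ t : ℤ_[3], G.aeval t = G4 * t ^ 4 + G2 * t ^ 2 + G1 * t + G0 := by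
    intro t
    rw [hG, Polynomial.coe_aeval_eq_eval]
    simp only [eval_add, eval_mul, eval_C, eval_pow, eval_X]
  have hGderiv : ∀ t : ℤ_[3], G.derivative.aeval t = 4 * G4 * t ^ 3 + 2 * G2 * t + G1 := by
    intro t
    rw [hG, Polynomial.coe_aeval_eq_eval]
    simp only [derivative_add, derivative_mul, derivative_C, derivative_X_pow, derivative_X,
      zero_mul, zero_add, mul_one, eval_add, eval_mul, eval_C, eval_pow, eval_X, Nat.cast_ofNat,
      add_zero]
    ring
  have hlin : G1 * a₀ + G0 = 0 := by
    rw [ha₀]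
    linear_combination (-G0) * hinv
  have hGa : G.aeval a₀ = G4 * a₀ ^ 4 + G2 * a₀ ^ 2 := by
    rw [hGeval]; linear_combination hlin
  have hsmall : ‖G.aeval a₀‖ < 1 := by
    rw [hGa]
    refine lt_of_le_of_lt (PadicInt.nonarchimedean _ _) (max_lt ?_ ?_)
    · rw [norm_mul]
      exact lt_of_le_of_lt (mul_le_of_le_one_right (norm_nonneg _) (PadicInt.norm_le_one _)) hN4
    · rw [norm_mul]
      exact lt_of_le_of_lt (mul_le_of_le_one_right (norm_nonneg _) (PadicInt.norm_le_one _)) hN2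
  have hderiv : ‖G.derivative.aeval a₀‖ = 1 := by
    rw [hGderiv]
    have hs : ‖4 * G4 * a₀ ^ 3 + 2 * G2 * a₀‖ < 1 := by
      refine lt_of_le_of_lt (PadicInt.nonarchimedean _ _) (max_lt ?_ ?_)
      · rw [norm_mul, norm_mul]
        calc ‖(4 : ℤ_[3])‖ * ‖G4‖ * ‖a₀ ^ 3‖ ≤ 1 * ‖G4‖ * 1 := by
              gcongr
              · exact PadicInt.norm_le_one _
              · exact PadicInt.norm_le_one _
          _ = ‖G4‖ := by ring
          _ < 1 := hN4
      · rw [norm_mul, norm_mul]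
        calc ‖(2 : ℤ_[3])‖ * ‖G2‖ * ‖a₀‖ ≤ 1 * ‖G2‖ * 1 := by
              gcongr
              · exact PadicInt.norm_le_one _
              · exact PadicInt.norm_le_one _
          _ = ‖G2‖ := by ring
          _ < 1 := hN2
    have hne : ‖4 * G4 * a₀ ^ 3 + 2 * G2 * a₀‖ ≠ ‖G1‖ := by rw [hN1]; exact hs.ne
    rw [PadicInt.norm_add_eq_max_of_ne hne, hN1, max_eq_right hs.le]
  have hnorm : ‖G.aeval a₀‖ < ‖G.derivative.aeval a₀‖ ^ 2 := by
    rw [hderiv, one_pow]; exact hsmall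
  -- Hensel, keeping `‖z − a₀‖ < 1`
  obtain ⟨z, hz, hz1, -⟩ := hensels_lemma hnorm
  rw [hderiv] at hz1
  -- `a₀` is a unit, hence so is `z`
  have ha₀n : ‖a₀‖ = 1 := by
    rw [ha₀, norm_mul, norm_neg, hN0, one_mul]
    exact PadicInt.isUnit_iff.mp (hU1.unit⁻¹).isUnit
  have hzn : ‖z‖ = 1 := by
    have h1 : z = (z - a₀) + a₀ := by ring
    have hne : ‖z - a₀‖ ≠ ‖a₀‖ := by rw [ha₀n]; exact hz1.ne
    rw [h1, PadicInt.norm_add_eq_max_of_ne hne, ha₀n, max_eq_right hz1.le]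
  have hzn' : ‖(z : ℚ_[3])‖ = 1 := by rw [PadicInt.padic_norm_e_of_padicInt]; exact hzn
  have hz0 : (z : ℚ_[3]) ≠ 0 := by
    intro h; rw [h, norm_zero] at hzn'; exact zero_ne_one hzn'
  have hzv : (z : ℚ_[3]).valuation = 0 := Literature.NumberTheory.NumberFields.valuation_eq_zero_of_norm_eq_one hzn'
  refine ⟨u * (z : ℚ_[3]), mul_ne_zero hu0 hz0, ?_, ?_⟩
  · rw [Padic.valuation_mul hu0 hz0, hvu, hzv, add_zero]
  have hz' : g4 * (z : ℚ_[3]) ^ 4 + g2 * (z : ℚ_[3]) ^ 2 + g1 * (z : ℚ_[3]) + g0 = 0 := by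
    have := congrArg (fun t : ℤ_[3] ↦ (t : ℚ_[3])) hz
    simp only [hGeval, PadicInt.coe_add, PadicInt.coe_mul, PadicInt.coe_pow,
      PadicInt.coe_zero] at this
    simpa [hG4, hG2, hG1, hG0] using this
  have key : 3 * (u * (z : ℚ_[3])) ^ 4 + 6 * (A : ℚ_[3]) * (u * (z : ℚ_[3])) ^ 2 +
      12 * (B : ℚ_[3]) * (u * (z : ℚ_[3])) - (A : ℚ_[3]) ^ 2 =
      w ^ 2 * (g4 * (z : ℚ_[3]) ^ 4 + g2 * (z : ℚ_[3]) ^ 2 + g1 * (z : ℚ_[3]) + g0) := by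
    rw [hg4, hg2, hg1, hg0]
    field_simp
    ring
  rw [key, hz', mul_zero]

/-- **The sign at the first-segment valuation.** For `A, B ∈ ℚ` non-zero with
`2·v₃(B) + 2 ≤ 3·v₃(A)` and ANY `x ∈ ℚ₃` of valuation `2v₃(A) − v₃(B) − 1`:
`4x³ + 4Ax + 4B = 4B·(1 + t)` with `‖t‖₃ < 1` — the summands `4x³`, `4Ax` have valuations
`3ν`, `v₃A + ν`, both strictly above `v₃B` since `3v₃A − 2v₃B ≥ 2`. [folklore] -/
theorem psi2Sq_eq_of_valuation {A B : ℚ} (hA : A ≠ 0) (hB : B ≠ 0)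
    (hlt : 2 * padicValRat 3 B + 2 ≤ 3 * padicValRat 3 A) {x : ℚ_[3]} (hx0 : x ≠ 0)
    (hv : x.valuation = 2 * padicValRat 3 A - padicValRat 3 B - 1) :
    ∃ t : ℚ_[3], ‖t‖ < 1 ∧
      4 * x ^ 3 + 4 * (A : ℚ_[3]) * x + 4 * (B : ℚ_[3]) = 4 * (B : ℚ_[3]) * (1 + t) := by
  have hA' : (A : ℚ_[3]) ≠ 0 := by exact_mod_cast hA
  have hB' : (B : ℚ_[3]) ≠ 0 := by exact_mod_cast hB
  have hvA : (A : ℚ_[3]).valuation = padicValRat 3 A := Padic.valuation_ratCast A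
  have hvB : (B : ℚ_[3]).valuation = padicValRat 3 B := Padic.valuation_ratCast B
  refine ⟨(x ^ 3 + (A : ℚ_[3]) * x) / (B : ℚ_[3]), ?_, by field_simp; ring⟩
  rcases eq_or_ne (x ^ 3 + (A : ℚ_[3]) * x) 0 with h0 | hne
  · rw [h0, zero_div, norm_zero]; exact one_pos
  refine norm_lt_one_of_valuation_pos (div_ne_zero hne hB') ?_
  have h3 : (x ^ 3).valuation = 3 * x.valuation := Padic.valuation_pow x 3
  have h1 : ((A : ℚ_[3]) * x).valuation = padicValRat 3 A + x.valuation := by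
    rw [Padic.valuation_mul hA' hx0, hvA]
  have hmin := Padic.le_valuation_add hne
  rw [h3, h1] at hmin
  rw [div_eq_mul_inv, Padic.valuation_mul hne (inv_ne_zero hB'), Padic.valuation_inv, hvB]
  rcases min_le_iff.mp hmin with h | h <;> omega

end PsiThreeAdic

/-! ## §2 Unit-part bookkeeping (`Additive/WildThreeResidualShape.lean` §1 currency) -/

section SignData

/-- The unit part is multiplicative on non-zero `3`-adic numbers. [folklore] -/
theorem unitPartThree_mul {s t : ℚ_[3]} (hs : s ≠ 0) (ht : t ≠ 0) :
    unitPartThree (s * t) = unitPartThree s * unitPartThree t := by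
  unfold unitPartThree
  have h3 : ((3 : ℕ) : ℚ_[3]) ≠ 0 := by norm_num
  rw [Padic.valuation_mul hs ht, neg_add, zpow_add₀ h3]
  ring

/-- A principal unit is its own unit part. [folklore] -/
theorem unitPartThree_of_norm_sub_one_lt {w : ℚ_[3]} (hw : ‖w - 1‖ < 1) : unitPartThree w = w := by
  unfold unitPartThree
  rw [(PsiThreeAdic.valuation_eq_zero_of_norm_sub_one_lt hw).2, neg_zero, zpow_zero, mul_one]

/-- **A factor whose unit part is `≡ 1 (mod 3)` does not change the class of the unit part.**
For `c, t ≠ 0` with `‖c·3^{−v₃c} − 1‖ < 1` and any `ε`: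
`UnitPartCongThree (c·t) ε ↔ UnitPartCongThree t ε`. [folklore] -/
theorem unitPartCongThree_mul_iff {c t ε : ℚ_[3]} (hc : c ≠ 0) (ht : t ≠ 0)
    (hγ : ‖unitPartThree c - 1‖ < 1) :
    UnitPartCongThree (c * t) ε ↔ UnitPartCongThree t ε := by
  unfold UnitPartCongThree
  rw [unitPartThree_mul hc ht]
  set γ := unitPartThree c
  set τ := unitPartThree t
  have hτ : ‖τ‖ = 1 := norm_unitPartThree ht
  have hsmall : ‖(γ - 1) * τ‖ < 1 := by rw [norm_mul, hτ, mul_one]; exact hγ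
  constructor
  · intro h
    have e : τ - ε = (γ * τ - ε) + -((γ - 1) * τ) := by ring
    rw [e]
    exact (Padic.nonarchimedean _ _).trans_lt (max_lt h (by rwa [norm_neg]))
  · intro h
    have e : γ * τ - ε = (γ - 1) * τ + (τ - ε) := by ring
    rw [e]
    exact (Padic.nonarchimedean _ _).trans_lt (max_lt hsmall h)

/-- The constant `−1/216 = −(1/8)·3⁻³` has unit part `−1/8 ≡ 1 (mod 3)` (`−1/8 − 1 = −9/8`), and
`3`-adic valuation `−3`. [folklore] -/
theorem unitPartThree_const :
    (-1 / 216 : ℚ_[3]) ≠ 0 ∧ (-1 / 216 : ℚ_[3]).valuation = -3 ∧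
      ‖unitPartThree (-1 / 216 : ℚ_[3]) - 1‖ < 1 := by
  have hq : (-1 / 216 : ℚ_[3]) = ((-1 / 216 : ℚ) : ℚ_[3]) := by push_cast; ring
  have hv : (-1 / 216 : ℚ_[3]).valuation = -3 := by
    rw [hq, Padic.valuation_ratCast, padicValRat.div (by norm_num) (by norm_num), padicValRat.neg,
      show (216 : ℚ) = (3 : ℚ) ^ 3 * 8 by norm_num, padicValRat.mul (by norm_num) (by norm_num),
      padicValRat.pow (3 : ℚ)]
    have h3 : padicValRat 3 (3 : ℚ) = 1 := by
      have := padicValRat.self (p := 3) (by norm_num); simpa using this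
    have h8 : padicValRat 3 (8 : ℚ) = 0 := by
      have : (8 : ℚ) = ((8 : ℕ) : ℚ) := by norm_num
      rw [this, padicValRat.of_nat]; simp only [Nat.cast_eq_zero]
      exact padicValNat.eq_zero_of_not_dvd (by norm_num)
    rw [padicValRat.one, h3, h8]; norm_num
  refine ⟨by norm_num, hv, ?_⟩
  unfold unitPartThree
  rw [hv, neg_neg]
  have e : (-1 / 216 : ℚ_[3]) * ((3 : ℕ) : ℚ_[3]) ^ (3 : ℤ) - 1 = ((3 : ℕ) : ℚ_[3]) ^ 2 * (-1 / 8) := by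
    push_cast; norm_num
  rw [e, norm_mul, norm_pow, Padic.norm_p]
  have h8 : ‖(-1 / 8 : ℚ_[3])‖ ≤ 1 := by
    rw [norm_div, norm_neg, norm_one]
    have : ‖(8 : ℚ_[3])‖ = 1 := by
      rw [show (8 : ℚ_[3]) = ((8 : ℕ) : ℚ_[3]) by norm_num, Padic.norm_natCast_eq_one_iff]; decide
    rw [this]; norm_num
  calc ((3 : ℕ) : ℝ)⁻¹ ^ 2 * ‖(-1 / 8 : ℚ_[3])‖ ≤ ((3 : ℕ) : ℝ)⁻¹ ^ 2 * 1 := by gcongr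
    _ < 1 := by norm_num

end SignData

end Summit.BirchSwinnertonDyer.Rank1Residual.Additive

end
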